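import Literature.Topology.FourManifolds.TriangularPresentationAndrewsCurtis
import Literature.Topology.FourManifolds.PresentationHandlebodyFive
import Literature.Topology.FourManifolds.CorkDecomposition
import Literature.Topology.FourManifolds.ClosedBall
import Mathlib.Geometry.Manifold.Diffeomorph
import HarnessLib

/-!
# Fission-tree presentations are Andrews–Curtis trivial (Gabai–Naylor–Schwartz 2025, Lemma 3.5)

Citation header.  D. Gabai, P. Naylor, H. Schwartz, *Doubles of Gluck twists: a five dimensional
approach*, Adv. Math. (2025), arXiv:2307.06388, §3.2, Lemmas 3.4 and 3.5.  What is reproduced: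

* (Lemma 3.5, the algebra, for an arbitrary fission TREE rather than the chain written in the
  paper.)  Let `S ⊂ S⁴` be a 2-knot given by a closed banded unlink diagram whose resolved unlink
  `L_β` has `m = ℓ + 1` components `e₀, …, e_ℓ`, joined into a tree by the `ℓ` fission bands, the
  `j`-th band (`j = 0, …, ℓ - 1`) joining `e_{j+1}` to an earlier component `e_{t(j)}`, `t(j) ≤ j`.
  In the standard handle structure of the punctured Gluck twist `Σ_S°` (GNS Def. 3.1) the
  1-handles are the dotted circles `e_i`, the Gluck 2-handle reads the relator `x₀` (it is the
  meridian of the first dotted circle) and the `j`-th fission 2-handle reads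
  `x_{j+1} ω_j x_{t(j)}⁻¹ ω_j⁻¹` for some word `ω_j` ("`x_{i+1} = ω_i x_i ω_i⁻¹`" in the paper's
  chain indexing).  This balanced sub-presentation — `BalancedPresentation.fissionTree t wd` — is
  TRIANGULAR for the rank function `rk(x_i) = i` and hence Andrews–Curtis equivalent to the
  trivial presentation by the three Andrews–Curtis moves, without stabilisation
  (`BalancedPresentation.isAndrewsCurtisEquivalent_trivial_fissionTree`, via the tree's
  `isAndrewsCurtisEquivalent_trivial_of_isConj_erase`); in particular it presents the trivial
  group.  GNS: *"It is easy to check that the resulting presentation is AC m-trivial."*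
* (Lemma 3.4, given the Andrews–Curtis 1965 thickening theorem as the tree's named fact
  `IsPresentationHandlebodyFive.nonempty_diffeomorph_closedBall_of_isStablyAndrewsCurtisEquivalent`.)
  Every presentation 5-manifold `W ≅ H⁵(P, ε)` of a triangular balanced presentation, in
  particular of a fission-tree presentation, is diffeomorphic to `𝔻⁵`, and its boundary is
  diffeomorphic to `𝕊⁴` (`nonempty_diffeomorph_closedBall_of_isConj_erase`,
  `nonempty_diffeomorph_sphere_boundary_of_fissionTree`).  In GNS this is the statement that the
  1- and 2-handles of `Σ_S° × I` other than the fusion 2-handles cancel ("`W^{(2)}` minus the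
  fusion handles is `B⁵`"), the first step of their proof of Theorem 1.1 and of the remark that
  `Σ_{S # -S}` is `(n - 1)`-stably standard when `S` has a diagram with `n` minima.

No new mathematics: the free-group computation is four lines and the rest is the tree's
triangular-presentation theorem (written there for Kirby's cork theorem, Addendum (C)) and the
named Andrews–Curtis fact.  Filed by the solo-informed seat of `SmoothPoincare4` as the formal
anchor of the algebraic step of its one-stabilisation remark.
-/

noncomputable section

open scoped Manifold ContDiff Topology
open Set Function

namespace Literature.Topology.FourManifolds

namespace BalancedPresentation

variable {ℓ : ℕ}

/-- **The fission-tree presentation** of Gabai–Naylor–Schwartz, Lemma 3.5: generators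
`x₀, …, x_ℓ` (the dotted circles `e₀, …, e_ℓ` of the upper ribbon disc), relator `0` equal to
`x₀` (the Gluck 2-handle, a meridian of the first dotted circle) and relator `j + 1` equal to
`x_{j+1} ω_j x_{t(j)}⁻¹ ω_j⁻¹` (the fission 2-handle dual to the band joining `e_{j+1}` to
`e_{t(j)}`).  [cite: GabaiNaylorSchwartz2025, Lemma 3.5 (proof)] -/
def fissionTree (t : Fin ℓ → Fin (ℓ + 1)) (wd : Fin ℓ → FreeGroup (Fin (ℓ + 1))) :
    BalancedPresentation (ℓ + 1) :=
  Fin.cons (FreeGroup.of 0)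
    (fun j => FreeGroup.of j.succ * wd j * (FreeGroup.of (t j))⁻¹ * (wd j)⁻¹)

/-- The Gluck relator is `x₀`. [cite: GabaiNaylorSchwartz2025, Lemma 3.5 (proof)] -/
@[simp]
theorem fissionTree_zero (t : Fin ℓ → Fin (ℓ + 1)) (wd : Fin ℓ → FreeGroup (Fin (ℓ + 1))) :
    fissionTree t wd 0 = FreeGroup.of 0 := by
  simp [fissionTree]

/-- The `j`-th fission relator is `x_{j+1} ω_j x_{t(j)}⁻¹ ω_j⁻¹`.
[cite: GabaiNaylorSchwartz2025, Lemma 3.5 (proof)] -/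
@[simp]
theorem fissionTree_succ (t : Fin ℓ → Fin (ℓ + 1)) (wd : Fin ℓ → FreeGroup (Fin (ℓ + 1)))
    (j : Fin ℓ) :
    fissionTree t wd j.succ = FreeGroup.of j.succ * wd j * (FreeGroup.of (t j))⁻¹ * (wd j)⁻¹ := by
  simp [fissionTree]

/-- **A fission-tree presentation is triangular** for the rank function `rk(x_i) = i`: killing
the generators of smaller index turns the `i`-th relator into `x_i` (for `i = j + 1` the
generator `x_{t(j)}`, `t(j) ≤ j < j + 1`, dies and the conjugating word cancels against its
inverse).  This is the content of GNS's "it is easy to check that the resulting presentation is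
AC m-trivial". [cite: GabaiNaylorSchwartz2025, Lemma 3.5 (proof)] -/
theorem fissionTree_isConj_erase (t : Fin ℓ → Fin (ℓ + 1)) (ht : ∀ j, ((t j : ℕ)) ≤ (j : ℕ))
    (wd : Fin ℓ → FreeGroup (Fin (ℓ + 1))) (i : Fin (ℓ + 1)) :
    IsConj (FreeGroup.lift (fun k : Fin (ℓ + 1) => if (k : ℕ) < (i : ℕ) then 1 else FreeGroup.of k)
      (fissionTree t wd i)) (FreeGroup.of i) := by
  induction i using Fin.cases with
  | zero =>
    rw [fissionTree_zero, FreeGroup.lift_apply_of, if_neg (lt_irrefl _)]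
  | succ j =>
    have h1 : ((t j : ℕ)) < ((j.succ : Fin (ℓ + 1)) : ℕ) := by
      rw [Fin.val_succ]
      exact Nat.lt_succ_of_le (ht j)
    have h2 : ¬ (((j.succ : Fin (ℓ + 1)) : ℕ) < ((j.succ : Fin (ℓ + 1)) : ℕ)) := lt_irrefl _
    rw [fissionTree_succ, map_mul, map_mul, map_mul, map_inv, map_inv, FreeGroup.lift_apply_of,
      FreeGroup.lift_apply_of, if_neg h2, if_pos h1, inv_one, mul_one, mul_inv_cancel_right]

/-- **Gabai–Naylor–Schwartz, Lemma 3.5 (for fission trees): the fission-tree presentation is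
Andrews–Curtis trivial**, by the three Andrews–Curtis moves and no stabilisation (the tree's
theorem on triangular presentations). [cite: GabaiNaylorSchwartz2025, Lemma 3.5] -/
theorem isAndrewsCurtisEquivalent_trivial_fissionTree (t : Fin ℓ → Fin (ℓ + 1))
    (ht : ∀ j, ((t j : ℕ)) ≤ (j : ℕ)) (wd : Fin ℓ → FreeGroup (Fin (ℓ + 1))) :
    IsAndrewsCurtisEquivalent (fissionTree t wd) (BalancedPresentation.trivial (ℓ + 1)) :=
  isAndrewsCurtisEquivalent_trivial_of_isConj_erase (fissionTree t wd) Fin.val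
    (fissionTree_isConj_erase t ht wd)

/-- In particular a fission-tree presentation is stably Andrews–Curtis trivial (with `0`
stabilisations). [cite: GabaiNaylorSchwartz2025, Lemma 3.5] -/
theorem isStablyAndrewsCurtisEquivalent_trivial_fissionTree (t : Fin ℓ → Fin (ℓ + 1))
    (ht : ∀ j, ((t j : ℕ)) ≤ (j : ℕ)) (wd : Fin ℓ → FreeGroup (Fin (ℓ + 1))) :
    IsStablyAndrewsCurtisEquivalent (fissionTree t wd) (BalancedPresentation.trivial (ℓ + 1)) :=
  isStablyAndrewsCurtisEquivalent_trivial_of_isConj_erase (fissionTree t wd) Fin.val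
    (fissionTree_isConj_erase t ht wd)

/-- In particular a fission-tree presentation presents the trivial group
(`π₁(B⁴₊₁(D)) = 1` for the `(+1)`-surgery of the 4-ball along a ribbon disc `D`, read from the
dotted circles and fission 2-handles). [cite: GabaiNaylorSchwartz2025, Lemma 3.5] -/
theorem presentsTrivialGroup_fissionTree (t : Fin ℓ → Fin (ℓ + 1))
    (ht : ∀ j, ((t j : ℕ)) ≤ (j : ℕ)) (wd : Fin ℓ → FreeGroup (Fin (ℓ + 1))) :
    (fissionTree t wd).PresentsTrivialGroup :=
  presentsTrivialGroup_of_isConj_erase (fissionTree t wd) Fin.val (fissionTree_isConj_erase t ht wd)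

end BalancedPresentation

open BalancedPresentation

/-- **A presentation 5-manifold of a triangular balanced presentation is the 5-ball, given the
Andrews–Curtis thickening theorem** (Andrews–Curtis 1965, as the tree's named fact): triangular
presentations are Andrews–Curtis trivial without stabilisation, so the fact applies.  This is
Gabai–Naylor–Schwartz's Lemma 3.4 ("the 1- and 2-handles cancel geometrically, leaving `B⁵`")
in the generality of Kirby's triangular presentations.
[cite: GabaiNaylorSchwartz2025, Lemma 3.4] [cite: AndrewsCurtis1965, Theorem] -/
theorem IsPresentationHandlebodyFive.nonempty_diffeomorph_closedBall_of_isConj_erase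
    (hAC :
      IsPresentationHandlebodyFive.nonempty_diffeomorph_closedBall_of_isStablyAndrewsCurtisEquivalent)
    {r : ℕ} (P : BalancedPresentation r) (rk : Fin r → ℕ)
    (h : ∀ i, IsConj (FreeGroup.lift (fun j => if rk j < rk i then 1 else FreeGroup.of j) (P i))
      (FreeGroup.of i))
    (W : Type) [TopologicalSpace W] [T2Space W] [SecondCountableTopology W]
    [ChartedSpace (EuclideanHalfSpace (4 + 1)) W] [IsManifold (𝓡∂ (4 + 1)) ∞ W] [CompactSpace W]
    (hW : IsPresentationHandlebodyFive P W) :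
    Nonempty (W ≃ₘ⟮𝓡∂ (4 + 1), 𝓡∂ (4 + 1)⟯
      (Metric.closedBall (0 : EuclideanSpace ℝ (Fin (4 + 1))) 1)) :=
  hAC r P W hW (isStablyAndrewsCurtisEquivalent_trivial_of_isConj_erase P rk h)

/-- **Gabai–Naylor–Schwartz, Lemma 3.4 with Lemma 3.5, given Andrews–Curtis 1965**: every
presentation 5-manifold of a fission-tree presentation — the 5-dimensional thickening of the
0-, 1-, fission- and Gluck-handles of a punctured Gluck twist `Σ_S°`, equivalently
`B⁴₊₁(D) × I` for the upper ribbon disc `D` — is diffeomorphic to `𝔻⁵`.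
[cite: GabaiNaylorSchwartz2025, Lemmas 3.4 and 3.5] [cite: AndrewsCurtis1965, Theorem] -/
theorem IsPresentationHandlebodyFive.nonempty_diffeomorph_closedBall_of_fissionTree
    (hAC :
      IsPresentationHandlebodyFive.nonempty_diffeomorph_closedBall_of_isStablyAndrewsCurtisEquivalent)
    {ℓ : ℕ} (t : Fin ℓ → Fin (ℓ + 1)) (ht : ∀ j, ((t j : ℕ)) ≤ (j : ℕ))
    (wd : Fin ℓ → FreeGroup (Fin (ℓ + 1)))
    (W : Type) [TopologicalSpace W] [T2Space W] [SecondCountableTopology W]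
    [ChartedSpace (EuclideanHalfSpace (4 + 1)) W] [IsManifold (𝓡∂ (4 + 1)) ∞ W] [CompactSpace W]
    (hW : IsPresentationHandlebodyFive (fissionTree t wd) W) :
    Nonempty (W ≃ₘ⟮𝓡∂ (4 + 1), 𝓡∂ (4 + 1)⟯
      (Metric.closedBall (0 : EuclideanSpace ℝ (Fin (4 + 1))) 1)) :=
  hAC (ℓ + 1) (fissionTree t wd) W hW (isStablyAndrewsCurtisEquivalent_trivial_fissionTree t ht wd)

/-- **The boundary of a presentation 5-manifold of a fission-tree presentation is `S⁴`, given
Andrews–Curtis 1965**: restrict the diffeomorphism with `𝔻⁵` to any boundary datum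
(`BoundaryData.restrictDiffeomorph`, `closedBallBoundaryData 4`).  In Gabai–Naylor–Schwartz's
setting this is the double `B⁴₊₁(D) ∪ -B⁴₊₁(D) ≅ S⁴` of the `(+1)`-surgered ribbon-disc exterior,
i.e. the Gluck twist of the ribbon 2-knot `D ∪ D̄` is standard.
[cite: GabaiNaylorSchwartz2025, Lemmas 3.4 and 3.5] [cite: AndrewsCurtis1965, Theorem] -/
theorem IsPresentationHandlebodyFive.nonempty_diffeomorph_sphere_boundary_of_fissionTree
    (hAC :
      IsPresentationHandlebodyFive.nonempty_diffeomorph_closedBall_of_isStablyAndrewsCurtisEquivalent)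
    {ℓ : ℕ} (t : Fin ℓ → Fin (ℓ + 1)) (ht : ∀ j, ((t j : ℕ)) ≤ (j : ℕ))
    (wd : Fin ℓ → FreeGroup (Fin (ℓ + 1)))
    (W : Type) [TopologicalSpace W] [T2Space W] [SecondCountableTopology W]
    [ChartedSpace (EuclideanHalfSpace (4 + 1)) W] [IsManifold (𝓡∂ (4 + 1)) ∞ W] [CompactSpace W]
    (hW : IsPresentationHandlebodyFive (fissionTree t wd) W)
    (b : BoundaryData (𝓡∂ (4 + 1)) W (𝓡 4)) :
    Nonempty (b.carrier ≃ₘ⟮𝓡 4, 𝓡 4⟯ (Metric.sphere (0 : EuclideanSpace ℝ (Fin (4 + 1))) 1)) := by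
  obtain ⟨Φ⟩ :=
    IsPresentationHandlebodyFive.nonempty_diffeomorph_closedBall_of_fissionTree hAC t ht wd W hW
  exact ⟨b.restrictDiffeomorph (closedBallBoundaryData 4) Φ⟩

end Literature.Topology.FourManifolds

end
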